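import Literature.AlgebraicGeometry.Frobenioids.DivisorMonoidBirationalPerfectProofs
import Literature.AlgebraicGeometry.Frobenioids.BirationalizationMorphisms
import Literature.AlgebraicGeometry.Frobenioids.BaseFrobeniusSections
import HarnessLib

/-!
# Frobenioids I, Proposition 4.8 (iv): the birationalization of a Frobenioid of isotropic and
# pre-model type is of isotropic and pre-model type — for THE birationalization

Mochizuki, *The geometry of Frobenioids I: the general theory*, Kyushu J. Math. **62** (2008)
293–400, §4, Proposition 4.8 (iv), kurims text p. 88 [cite: MochizukiFrdI2008, Prop. 4.8 (iv) p.88]: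
"(iv) If `C` is of isotropic and pre-model type, then so is `C^birat`", with the printed proof
"assertion (iv) follows formally [from] Proposition 4.4, (iv) [cf. also assertion (i)]".

"Pre-model type" is Def. 2.7 (iii) (seat abc-iut-L1-t2, `BaseFrobeniusSections.lean`:
`PreFrobenioid.IsOfPreModelType F` = `C` admits a base-Frobenius pair `(P, F)`: a base-section
`P ⊆ C^pl-bk` — a skeleton of Frobenius-trivial objects with `P → D` an equivalence — and a
`P`-Frobenius-section `F : ℕ_{≥1} → End(P ↪ C)`). The transfer to `C^birat` (seat abc-iut-L6-t8's
`Birat F hF hsq` with its structure `Birat.toElemZero hF hsq : C^birat → F_{0_D}`) is the image of the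
pair under `C → C^birat`:

* `Presection.birat P hF hsq` — the image presection `P^birat` (same objects; arrows = images of arrows
  of `P`), DEFINED; `Presection.toBiratCat` — the functor `P ⥤ P^birat` (identity on objects), an
  equivalence because `C → C^birat` is faithful (Prop. 4.4 (ii)); `Presection.biratEnd` — the induced
  homomorphism `End(P ↪ C) → End(P^birat ↪ C^birat)`, DEFINED;
* `PreFrobenioid.Birat.isBaseSection` — `P^birat` is a base-section of `C^birat`: arrows of `P` are
  pull-back morphisms, hence so are their images (Prop. 4.4 (iv), abc-iut-L6-t8's
  `Birat.isPullbackMorphism_toBirat_map`); skeleton (faithfulness); Frobenius-trivial objects (images of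
  the Frobenius-trivialising sections; Frobenius type in `C^birat` = base-isomorphism for `C` of
  isotropic type, Prop. 4.8 (i)); `P^birat → D` ≅ (`P ⥤ P^birat`)⁻¹ ⋙ (`P → D`), an equivalence;
* `PreFrobenioid.Birat.isFrobeniusSection`, **`PreFrobenioid.Birat.isOfPreModelType`** — Prop. 4.8 (iv)
  (pre-model half; the isotropic half is `Birat.isOfIsotropicType`), and the conjunction
  `PreFrobenioid.Birat.prop48iv`.

Seat abc-iut-L1-t3's `PreFrobenioidData.Prop48iv` takes "pre-model type" as a FREE predicate parameter
on `PreFrobenioidData` (a schema); the honest instance is the functor-level statement proved here over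
abc-iut-L1-t2's definition. ERRATUM NOTE: the author's "Comments on [FrdI]" (Jan. 2024), item
(29)(iv), replace "pre-model type" by "model type" (= pre-model and birationally Frobenius-normalized,
Def. 4.5 (i)) in Prop. 4.8 (iv); the transfer of a base-Frobenius pair proved here uses only the 2008
hypotheses (isotropic and pre-model type) and never the Frobenioid-ness of `C^birat`, so the 2008
pre-model statement stands as proved (the "model type" version additionally asks for the transfer of
birational Frobenius-normalization, not treated here).

Node `FrdI:Prop4.8(iv)` (abc-iut cell, seat abc-iut-L6-t20). No statement of the paper is strengthened;
nothing here concerns the disputed parts of IUT.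
-/

noncomputable section

namespace Literature.AlgebraicGeometry.Frobenioids

open CategoryTheory Opposite

universe w v v' u u'

variable {D : Type u} [Category.{v} D] {Φ : Dᵒᵖ ⥤ CommMonCat.{w}}
  {C : Type u'} [Category.{v'} C] {F : C ⥤ ElemFrobenioid Φ}

namespace Presection

variable (P : Presection C) (hF : PreFrobenioid.IsFrobenioid F) (hsq : PreFrobenioid.HasBiratSquares F)

/-- The image `P^birat` of a subcategory `P ⊆ C` in `C^birat`: the same objects, and the images under
`C → C^birat` of the arrows of `P` (closed under composition by functoriality).
[cite: MochizukiFrdI2008, Prop. 4.8 (iv) p.88] -/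
def birat : Presection (PreFrobenioid.Birat F hF hsq) where
  obj X := P.obj X.out
  hom {X Y} g := ∃ f : X.out ⟶ Y.out, P.hom f ∧ (PreFrobenioid.toBirat F hF hsq).map f = g
  obj_of_hom g := fun ⟨f, hf, _⟩ => P.obj_of_hom f hf
  hom_id {X} hX := ⟨𝟙 X.out, P.hom_id hX, (PreFrobenioid.toBirat F hF hsq).map_id _⟩
  hom_comp {X Y Z} g g' := fun ⟨f, hf, e⟩ ⟨f', hf', e'⟩ =>
    ⟨f ≫ f', P.hom_comp f f' hf hf', by rw [Functor.map_comp, e, e']; rfl⟩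

/-- The functor `P ⥤ P^birat` induced by `C → C^birat` (identity on objects).
[cite: MochizukiFrdI2008, Prop. 4.8 (iv) p.88] -/
def toBiratCat : P.Cat ⥤ (P.birat hF hsq).Cat where
  obj A := ⟨(PreFrobenioid.toBirat F hF hsq).obj A.1, A.2⟩
  map f := ⟨(PreFrobenioid.toBirat F hF hsq).map f.1, f.1, f.2, rfl⟩
  map_id A := Subtype.ext ((PreFrobenioid.toBirat F hF hsq).map_id A.1)
  map_comp f g := Subtype.ext ((PreFrobenioid.toBirat F hF hsq).map_comp f.1 g.1)

/-- `P ⥤ P^birat` is full (by definition of the arrows of `P^birat`).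
[cite: MochizukiFrdI2008, Prop. 4.8 (iv) p.88] -/
instance toBiratCat_full : (P.toBiratCat hF hsq).Full where
  map_surjective {A B} := by
    rintro ⟨g, f, hf, e⟩
    exact ⟨⟨f, hf⟩, Subtype.ext e⟩

/-- `P ⥤ P^birat` is faithful (`C → C^birat` is faithful, Prop. 4.4 (ii)).
[cite: MochizukiFrdI2008, Prop. 4.4 (ii) p.83] -/
instance toBiratCat_faithful : (P.toBiratCat hF hsq).Faithful where
  map_injective {A B} := by
    intro f f' h
    haveI := PreFrobenioid.toBirat_faithful hF hsq
    have h' := congrArg Subtype.val h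
    exact Subtype.ext ((PreFrobenioid.toBirat F hF hsq).map_injective h')

/-- `P ⥤ P^birat` is essentially surjective (identity on objects).
[cite: MochizukiFrdI2008, Prop. 4.8 (iv) p.88] -/
instance toBiratCat_essSurj : (P.toBiratCat hF hsq).EssSurj where
  mem_essImage X := ⟨⟨X.1.out, X.2⟩, ⟨Iso.refl _⟩⟩

/-- `P ⥤ P^birat` is an equivalence of categories. [cite: MochizukiFrdI2008, Prop. 4.8 (iv) p.88] -/
instance toBiratCat_isEquivalence : (P.toBiratCat hF hsq).IsEquivalence where

/-- `P ⥤ P^birat ⥤ C^birat → D` is `P → D` (base objects and base maps are preserved by `C → C^birat`,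
Prop. 4.4 (i)). [cite: MochizukiFrdI2008, Prop. 4.4 (i) p.83] -/
def toBiratCatCompToBaseIso :
    P.toBiratCat hF hsq ⋙ (P.birat hF hsq).toBase (PreFrobenioid.Birat.toElemZero hF hsq) ≅
      P.toBase F :=
  NatIso.ofComponents (fun _ => Iso.refl _) fun f =>
    (Category.comp_id _).trans
      ((PreFrobenioid.Birat.base_toElemZero_map (hF := hF) (hsq := hsq) f.1).trans
        (Category.id_comp _).symm)

/-- The homomorphism `End(P ↪ C) → End(P^birat ↪ C^birat)` induced by `C → C^birat`: an endomorphism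
`ε` of the inclusion functor is sent to the family `(ε_A)^birat`, natural on the arrows of `P^birat`
(images of arrows of `P`). [cite: MochizukiFrdI2008, Prop. 4.8 (iv) p.88] -/
def biratEnd : End P.ι →* End (P.birat hF hsq).ι where
  toFun ε :=
    { app := fun X => (PreFrobenioid.toBirat F hF hsq).map (ε.app ⟨X.1.out, X.2⟩)
      naturality := by
        rintro X Y ⟨g, f, hf, e⟩
        subst e
        change (PreFrobenioid.toBirat F hF hsq).map f ≫
            (PreFrobenioid.toBirat F hF hsq).map (ε.app ⟨Y.1.out, Y.2⟩) =
          (PreFrobenioid.toBirat F hF hsq).map (ε.app ⟨X.1.out, X.2⟩) ≫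
            (PreFrobenioid.toBirat F hF hsq).map f
        have hn := ε.naturality (X := ⟨X.1.out, X.2⟩) (Y := ⟨Y.1.out, Y.2⟩) ⟨f, hf⟩
        change f ≫ ε.app ⟨Y.1.out, Y.2⟩ = ε.app ⟨X.1.out, X.2⟩ ≫ f at hn
        exact ((PreFrobenioid.toBirat F hF hsq).map_comp f _).symm.trans
          ((congrArg (PreFrobenioid.toBirat F hF hsq).map hn).trans
            ((PreFrobenioid.toBirat F hF hsq).map_comp _ f)) }
  map_one' := by
    apply NatTrans.ext; funext X
    change (PreFrobenioid.toBirat F hF hsq).map ((𝟙 P.ι : P.ι ⟶ P.ι).app ⟨X.1.out, X.2⟩) = 𝟙 X.1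
    rw [NatTrans.id_app, CategoryTheory.Functor.map_id]
    rfl
  map_mul' ε ε' := by
    apply NatTrans.ext; funext X
    change (PreFrobenioid.toBirat F hF hsq).map ((ε' ≫ ε).app ⟨X.1.out, X.2⟩) =
      (PreFrobenioid.toBirat F hF hsq).map (ε'.app ⟨X.1.out, X.2⟩) ≫
        (PreFrobenioid.toBirat F hF hsq).map (ε.app ⟨X.1.out, X.2⟩)
    rw [NatTrans.comp_app, CategoryTheory.Functor.map_comp]

/-- Components of `biratEnd`. [cite: MochizukiFrdI2008, Prop. 4.8 (iv) p.88] -/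
theorem biratEnd_app (ε : End P.ι) (X : (P.birat hF hsq).Cat) :
    (P.biratEnd hF hsq ε).app X = (PreFrobenioid.toBirat F hF hsq).map (ε.app ⟨X.1.out, X.2⟩) := rfl

end Presection

namespace PreFrobenioid

namespace Birat

variable {hF : IsFrobenioid F} {hsq : HasBiratSquares F}

/-- Pull-back morphisms for `C^birat → F_{0_D}` are those for `C^birat → F_{Φ^gp}` (the notion only
involves bases, which `F_{Φ^gp} → F_{0_D}` preserves). [cite: MochizukiFrdI2008, Prop. 4.4 (iv) p.83] -/
theorem isPullbackMorphism_toElemZero_iff {X Y : Birat F hF hsq} (g : X ⟶ Y) :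
    IsPullbackMorphism (toElemZero hF hsq) g ↔ IsPullbackMorphism (toElemGp hF hsq) g := Iff.rfl

/-- Frobenius-trivial objects of `C` are Frobenius-trivial in `C^birat` when `C` is of isotropic type
(the image of a Frobenius-trivialising section: degrees and bases are preserved, and base-isomorphisms
of `C^birat` are of Frobenius type, Prop. 4.8 (i)). [cite: MochizukiFrdI2008, Prop. 4.8 (iv) p.88] -/
theorem isFrobeniusTrivial (hiso : IsOfIsotropicType F) {A : C} (h : IsFrobeniusTrivial F A) :
    IsFrobeniusTrivial (toElemZero hF hsq) ((toBirat F hF hsq).obj A) := by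
  obtain ⟨ζ, hζ⟩ := h
  refine ⟨((toBirat F hF hsq).mapEnd A).comp ζ, fun n => ⟨(hζ n).1, ?_, ?_⟩⟩
  · change Base (toElemZero hF hsq) ((toBirat F hF hsq).map (ζ n)) = 𝟙 _
    rw [base_toElemZero_map]
    exact (hζ n).2.1
  · exact (isFrobeniusType_iff_isBaseIso hiso _).mpr (isBaseIso_toElemZero_map (hζ n).2.2.2)

variable (hF hsq)

/-- **Prop. 4.8 (iv)**, base-section: for `C` of isotropic type and a base-section `P` of `C`, the
image `P^birat` is a base-section of `C^birat`. [cite: MochizukiFrdI2008, Prop. 4.8 (iv) p.88] -/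
theorem isBaseSection (hiso : IsOfIsotropicType F) {P : Presection C} (hP : IsBaseSection F P) :
    IsBaseSection (toElemZero hF hsq) (P.birat hF hsq) where
  hom_pullback := by
    rintro X Y g ⟨f, hf, rfl⟩
    exact (isPullbackMorphism_toElemZero_iff _).mpr (isPullbackMorphism_toBirat_map (hP.hom_pullback f hf))
  isSkeleton := by
    rintro A B ⟨e⟩
    obtain ⟨f, hf, ef⟩ := e.hom.2
    obtain ⟨f', hf', ef'⟩ := e.inv.2
    haveI := toBirat_faithful hF hsq
    have h₁ : f ≫ f' = 𝟙 _ := by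
      apply (toBirat F hF hsq).map_injective
      have h := congrArg Subtype.val e.hom_inv_id
      simp only [Presection.comp_val, Presection.id_val] at h
      rw [← ef, ← ef'] at h
      rw [CategoryTheory.Functor.map_comp, CategoryTheory.Functor.map_id]
      exact h
    have h₂ : f' ≫ f = 𝟙 _ := by
      apply (toBirat F hF hsq).map_injective
      have h := congrArg Subtype.val e.inv_hom_id
      simp only [Presection.comp_val, Presection.id_val] at h
      rw [← ef, ← ef'] at h
      rw [CategoryTheory.Functor.map_comp, CategoryTheory.Functor.map_id]
      exact h
    have hAB : (⟨A.1.out, A.2⟩ : P.Cat) = ⟨B.1.out, B.2⟩ :=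
      hP.isSkeleton _ _ ⟨P.isoMk (A := ⟨A.1.out, A.2⟩) (B := ⟨B.1.out, B.2⟩) ⟨f, f', h₁, h₂⟩ hf hf'⟩
    exact Subtype.ext (congrArg Subtype.val hAB)
  isFrobeniusTrivial X hX := isFrobeniusTrivial hiso (hP.isFrobeniusTrivial X.out hX)
  isEquivalence := by
    haveI := hP.isEquivalence
    haveI : (P.toBiratCat hF hsq ⋙ (P.birat hF hsq).toBase (toElemZero hF hsq)).IsEquivalence :=
      Functor.isEquivalence_of_iso (P.toBiratCatCompToBaseIso hF hsq).symm
    exact Functor.isEquivalence_of_comp_left (P.toBiratCat hF hsq) _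

/-- **Prop. 4.8 (iv)**, Frobenius-section: for `C` of isotropic type and a `P`-Frobenius-section `F` of
`C`, the image `F^birat : ℕ_{≥1} → End(P^birat ↪ C^birat)` is a `P^birat`-Frobenius-section of `C^birat`.
[cite: MochizukiFrdI2008, Prop. 4.8 (iv) p.88] -/
theorem isFrobeniusSection (hiso : IsOfIsotropicType F) {P : Presection C} {Fr : ℕ+ →* End P.ι}
    (hFr : IsFrobeniusSection F P Fr) :
    IsFrobeniusSection (toElemZero hF hsq) (P.birat hF hsq) ((P.biratEnd hF hsq).comp Fr) where
  degFr_eq n X := hFr.degFr_eq n ⟨X.1.out, X.2⟩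
  isBaseIdentity n X := by
    change Base (toElemZero hF hsq) ((toBirat F hF hsq).map ((Fr n).app ⟨X.1.out, X.2⟩)) = 𝟙 _
    rw [base_toElemZero_map]
    exact hFr.isBaseIdentity n ⟨X.1.out, X.2⟩
  isFrobeniusType n X :=
    (isFrobeniusType_iff_isBaseIso hiso _).mpr
      (isBaseIso_toElemZero_map (hFr.isFrobeniusType n ⟨X.1.out, X.2⟩).2)

/-- **[FrdI] Proposition 4.8 (iv)**, pre-model half, for THE birationalization: if `C` is of isotropic
and pre-model type then `C^birat` is of pre-model type (the image of a base-Frobenius pair is a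
base-Frobenius pair). [cite: MochizukiFrdI2008, Prop. 4.8 (iv) p.88] -/
theorem isOfPreModelType (hiso : IsOfIsotropicType F) (h : IsOfPreModelType F) :
    IsOfPreModelType (toElemZero hF hsq) := by
  obtain ⟨P, Fr, hPF⟩ := h
  exact ⟨P.birat hF hsq, (P.biratEnd hF hsq).comp Fr,
    ⟨isBaseSection hF hsq hiso hPF.isBaseSection, isFrobeniusSection hF hsq hiso hPF.isFrobeniusSection⟩⟩

/-- **[FrdI] Proposition 4.8 (iv)** for THE birationalization: "If `C` is of isotropic and pre-model
type, then so is `C^birat`." [cite: MochizukiFrdI2008, Prop. 4.8 (iv) p.88] -/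
theorem prop48iv (hiso : IsOfIsotropicType F) (h : IsOfPreModelType F) :
    IsOfIsotropicType (toElemZero hF hsq) ∧ IsOfPreModelType (toElemZero hF hsq) :=
  ⟨isOfIsotropicType hiso, isOfPreModelType hF hsq hiso h⟩

end Birat

end PreFrobenioid

end Literature.AlgebraicGeometry.Frobenioids
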